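import Summits.CriticalPhenomena.Ising3DConformalLimit.Theses.EnergyNotSigmaSquared
import Summits.CriticalPhenomena.Ising3DConformalLimit.Theorems.EnergyNotSigmaSquaredEnergyGapSoftRatioRegular
import Summits.CriticalPhenomena.Ising3DConformalLimit.Theorems.EnergyNotSigmaSquaredEnergyGapPowerLawRayGrowth
import Summits.CriticalPhenomena.Ising3DConformalLimit.Theorems.EnergyNotSigmaSquaredEnergyGapPowerLawRayRatioPowerBound
import Literature.Probability.Percolation.LocalLimitConnections
import Summits.CriticalPhenomena.Ising3DConformalLimit.Theorems.EnergyNotSigmaSquaredEnergyGapPowerLawOnePairing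
import Literature.Probability.LatticeModels.SourcedDoubleCurrentsSwitchingProofs
import Literature.Probability.LatticeModels.CriticalTwoPointLower
import Summits.CriticalPhenomena.Ising3DConformalLimit.Theorems.EnergyNotSigmaSquaredEnergyGapPowerLawTelescoping

/-!
# Skeleton for crux `EnergyGapPowerLaw` — item stmt-CriticalPhenomena-4469, line `registered`
# (birth skeleton `Lines/birth.lean`, reshaped by the lead prover-line-stmt-CriticalPhenomena-4469-0)

Crux (concluded BY NAME below):
`Summit.CriticalPhenomena.Ising3DConformalLimit.Theses.EnergyNotSigmaSquared.EnergyGapPowerLaw`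
`= ∃ κ > 0, ∃ C, ∀ x ≠ 0, T(x) := ⟨σ₀σ_{e₂}σ_xσ_{x+e₂}⟩_{β_c} − ⟨σ₀σ_{e₂}⟩⟨σ_xσ_{x+e₂}⟩ ≤ C‖x‖^{-κ} G(x)²`
(`G = criticalTwoPoint 3`, `e₂ = Pi.single 1 1`, plus/critical state of `ℤ³`).

## The line: ONE PAIRING SUFFICES — parallel avoidance decay + a quantitative ray lemma

`T = 2G²·A_par + (G₊G₋ − G²)` (`adjacentTruncation_eq_ursell`, tied pairings `pairings_tied`), so GAP
splits into (i) `A_par ≤ C‖x‖^{-κ}` (stub 1, the heart) and (ii) power-rate asymptotic log-CONCAVITY of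
`G` in direction `e₂`.  Stub 1 gives power-rate log-CONVEXITY for free (`logConvexity_of_parAvoidance`),
and the quantitative ray lemma converts convexity into concavity.

## Reshape (lead, cycle 1): the ray lemma is split into two worker-sized registered stubs

* `stub_rayGrowth` (S, pure algebra): along a ray `x + ℕe`, if consecutive ratios lose at most a
  factor `1 − η` per step (`(1−η)F(y)² ≤ F(y+e)F(y−e)` at the `L − 1` interior points) and the first
  ratio satisfies `a ≤ (1 − Lη)·F(x+e)/F(x)`, then `a^L F(x) ≤ F(x + L e)` (Bernoulli `(1−η)^j ≥ 1 − jη`).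
* `stub_rayRatioPowerBound` (M, real analysis, ABSTRACT positive lattice function `F`): growth +
  polynomial ray ceiling `F(x+Ke) ≤ c⁻¹K²F(x)` + power-rate log-convexity
  `(1 − C‖y‖^{-κ})F(y)² ≤ F(y+e)F(y−e)` (`y ≠ 0`, `0 < κ ≤ 1`, `0 ≤ C`) ⟹
  `F(x+e)/F(x) ≤ 1 + C'‖x‖^{-κ'}` for `‖x‖ ≥ R` (recipe: `κ' = κ/5`; if the ratio exceeds
  `1 + N^{-κ'}`, `N = ‖x‖`, run growth with `L = 3K`, `K = ⌊72N^{3κ'}/c⌋ + 1`, `η = C(N/2)^{-κ}`,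
  `a = 1 + N^{-κ'}/2`; Bernoulli cubed `a^{3K} ≥ (K N^{-κ'}/2)³` beats the ceiling `9K²/c`).
* `stub_rayLogConcavity` is now a THEOREM of this file: the two stubs applied to `F = G` in the
  directions `e₂` and `−e₂` (the convexity hypothesis is symmetric under `e ↦ −e`), the ceiling
  `exists_ray_ceiling`, small `x` absorbed by `G(x+e)/G(x) ≤ G(e)⁻¹` (GKS), and
  `G₊G₋/G² = (G(x+e₂)/G(x))·(G(x−e₂)/G(x)) ≤ (1 + Mρ)² ≤ 1 + (2M + M²)ρ`, `ρ = ‖x‖^{-κ'} ≤ 1`.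

## Registered stubs

* `stub_scaleMergingFloor` (XL, OPEN — the heart as a MECHANISM: per-scale conditional merging floor on
  a positive density of dyadic scales, finite volume; all `d = 3` input lives here; held by the lead).
* `stub_telescoping` (S/M) — LANDED p162987 (`Theorems/…Telescoping.lean`): mechanism ⟹ finite-volume heart.
* `stub_localParAvoidancePowerLaw` — the finite-volume heart (crux-EQUIVALENT), now DERIVED
  (`:= stub_telescoping stub_scaleMergingFloor`); the birth stub `stub_parAvoidancePowerLaw`
  (infinite volume, crux-EQUIVALENT) is DERIVED from it through
* `stub_localisation` (S) — the localisation glue, LANDED p145825 (`Theorems/…Localisation.lean`, which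
  also proves the converse `local_of_parAvoidancePowerLaw`: nothing is lost).
* `stub_rayGrowth` (S) — LANDED, wave 1, p143171 (`Theorems/EnergyNotSigmaSquaredEnergyGapPowerLawRayGrowth.lean`).
* `stub_rayRatioPowerBound` (M) — LANDED, wave 1, p143376
  (`Theorems/EnergyNotSigmaSquaredEnergyGapPowerLawRayRatioPowerBound.lean`).
* `stub_onePairingReduction` (M) — the reduction `ParAvoidancePowerLaw → EnergyGapPowerLaw`, proved by the
  glue of this file (`stub_onePairingReduction_of_glue`) and landing as
  `Theorems/EnergyNotSigmaSquaredEnergyGapPowerLawOnePairing.lean` (which also proves the converse: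
  `energyGapPowerLaw_iff_parAvoidancePowerLaw`).

`EnergyGapPowerLaw_of : <stub₁> → <stub_rayGrowth> → <stub_rayRatioPowerBound> → EnergyGapPowerLaw`
is proved below without `sorry`;
`energyGapPowerLaw_skeleton := stub_onePairingReduction (stub_localisation (stub_telescoping stub_scaleMergingFloor))`.

## Disproof used (Cruxes/EnergyGapPowerLaw/Disproof.lean, gen 2)

* `energyGapPowerLaw_false_without_neZero` (D§4): `x ≠ 0` is load-bearing — kept in stub 1 and in the
  convexity hypothesis (`‖y‖ ≥ 1` on `ℤ³ ∖ {0}` is what lets `κ ↦ min κ 1`, `C ↦ max C 0` normalise).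
* `energyGapPowerLawWithoutPosKappa_holds` / `energyGapKappaZero_dimensionUniform` (D§3, D§6): `0 < κ`
  enters ONLY through stub 1; the ray stubs are dimension-blind by design (the transfer).
* `energyGapPowerLaw_iff_par_and_ratio` (D§8): this skeleton IS that split with the ratio half
  discharged; `secondRatioPowerRegular_of_energyGapPowerLaw` (D§7): nothing is lost.
* D§9 (axis dead end for two-point LOWER bounds): not used — only upper bounds on `T` are needed.
-/

noncomputable section

namespace Summit.CriticalPhenomena.Ising3DConformalLimit.Cruxes.EnergyGapPowerLaw.Birth

open scoped symmDiff
open MeasureTheory Filter Topology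
open Literature.Probability.LatticeModels Literature.Probability.Percolation
open Summit.CriticalPhenomena.Ising3DConformalLimit.Theses.EnergyNotSigmaSquared (EnergyGapPowerLaw)
open Summit.CriticalPhenomena.Ising3DConformalLimit.EnergyNotSigmaSquaredEnergyGapSoft
  (adjacentTruncation_eq_ursell pairings_tied sourcedDoubleCurrentLawInf_real_le_one
   exists_ray_ceiling criticalTwoPoint_add_mul_le)
open Summit.CriticalPhenomena.Ising3DConformalLimit.PinnedClusterPoints (criticalTwoPoint_pos3)

/-! ## The registered stubs -/

/-- **Stub 1-mech (XL, OPEN; the heart as a MECHANISM — a per-scale conditional merging floor on a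
positive density of dyadic scales, finite volume).**  There are `q, δ > 0` and `R` such that for every
`x` with `‖x‖ ≥ R` and all large `L`, under `P_L = sourcedDoubleCurrentLaw 3 L β_c ({0}∆{x}) ({e₂}∆{x+e₂})`
there is a set `K` of scales, `#K ≥ δ log₂‖x‖`, each `k ∈ K` with `2^{k+1} ≤ ‖x‖` and
`1 − P_L[0 ↔ e₂ inside Λ_{2^{k+1}}] ≤ (1 − q)·(1 − P_L[0 ↔ e₂ inside Λ_{2^k}])`, i.e. CONDITIONALLY on the
two clusters not having joined `0` to `e₂` inside `Λ_{2^k}`, they do so inside `Λ_{2^{k+1}}` with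
probability `≥ q`.  This is the route's intended mechanism ("harvest `B(β_c)=∞` scale by scale with a
cross-scale decoupling"); it implies the finite-volume heart by telescoping (`stub_telescoping`, LANDED)
and is where ALL `d = 3` input lives (false for `d ≥ 5`: the conditional merging probability per octave
tends to `0` when the bubble converges).  Inputs on file: per-scale second moments (ADC21 Prop. A.3,
tree `IntersectionSecondMoment`), Panis 2025 sourced mixing / IIC (qualitative), the four idea cards. -/
theorem stub_scaleMergingFloor :
    ∃ q δ R : ℝ, 0 < q ∧ 0 < δ ∧ ∀ x : Site 3, R ≤ ‖x‖ → ∀ᶠ L : ℕ in atTop,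
      ∃ K : Finset ℕ, δ * Real.logb 2 ‖x‖ ≤ (K.card : ℝ) ∧ ∀ k ∈ K, (2 : ℝ) ^ (k + 1) ≤ ‖x‖ ∧
        1 - (sourcedDoubleCurrentLaw 3 L (criticalBeta 3) ({0} ∆ {x})
              ({(Pi.single 1 1 : Site 3)} ∆ {x + Pi.single 1 1})).real
            (openConnVia (withinGraph ⊤ (↑(box 3 (2 ^ (k + 1))) : Set (Site 3))) 0 (Pi.single 1 1)) ≤
          (1 - q) * (1 - (sourcedDoubleCurrentLaw 3 L (criticalBeta 3) ({0} ∆ {x})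
              ({(Pi.single 1 1 : Site 3)} ∆ {x + Pi.single 1 1})).real
            (openConnVia (withinGraph ⊤ (↑(box 3 (2 ^ k)) : Set (Site 3))) 0 (Pi.single 1 1))) := by
  sorry

/-- **Stub 1-tel (S/M, LANDED p162987 as `Theorems/EnergyNotSigmaSquaredEnergyGapPowerLawTelescoping.lean`;
telescoping):** the mechanism stub implies the finite-volume heart (`a_k = 1 − P_L[Conn_{2^k}]` is
antitone, contracts by `1 − q ∧ ½` on `K ⊆ range ⌊log₂‖x‖⌋`, so `a_{2^{⌊log₂‖x‖⌋}} ≤ (1−q∧½)^{δ log₂‖x‖}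
= ‖x‖^{-κ}`, `κ = δ log₂(1/(1−q∧½))`; small `x` absorbed in the constant). -/
theorem stub_telescoping :
    (∃ q δ R : ℝ, 0 < q ∧ 0 < δ ∧ ∀ x : Site 3, R ≤ ‖x‖ → ∀ᶠ L : ℕ in atTop,
      ∃ K : Finset ℕ, δ * Real.logb 2 ‖x‖ ≤ (K.card : ℝ) ∧ ∀ k ∈ K, (2 : ℝ) ^ (k + 1) ≤ ‖x‖ ∧
        1 - (sourcedDoubleCurrentLaw 3 L (criticalBeta 3) ({0} ∆ {x})
              ({(Pi.single 1 1 : Site 3)} ∆ {x + Pi.single 1 1})).real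
            (openConnVia (withinGraph ⊤ (↑(box 3 (2 ^ (k + 1))) : Set (Site 3))) 0 (Pi.single 1 1)) ≤
          (1 - q) * (1 - (sourcedDoubleCurrentLaw 3 L (criticalBeta 3) ({0} ∆ {x})
              ({(Pi.single 1 1 : Site 3)} ∆ {x + Pi.single 1 1})).real
            (openConnVia (withinGraph ⊤ (↑(box 3 (2 ^ k)) : Set (Site 3))) 0 (Pi.single 1 1)))) →
    ∃ κ C : ℝ, 0 < κ ∧ ∀ x : Site 3, x ≠ 0 → ∃ N : ℕ, ∀ᶠ L : ℕ in atTop,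
      1 - (sourcedDoubleCurrentLaw 3 L (criticalBeta 3) ({0} ∆ {x})
            ({(Pi.single 1 1 : Site 3)} ∆ {x + Pi.single 1 1})).real
          (openConnVia (withinGraph ⊤ (↑(box 3 N) : Set (Site 3))) 0 (Pi.single 1 1)) ≤
        C * (‖x‖ : ℝ) ^ (-κ) :=
  -- LANDED (lead, p162987): Theorems/EnergyNotSigmaSquaredEnergyGapPowerLawTelescoping.lean
  Summit.CriticalPhenomena.Ising3DConformalLimit.EnergyNotSigmaSquaredEnergyGapPowerLaw.stub_telescoping

/-- **Stub 1-loc (the heart in FINITE volume; the registered open stub until this reshape, now DERIVED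
from stubs 1-mech and 1-tel — local parallel adjacent avoidance decays as a power).**  For some `κ > 0`,
`C`: for every `x ≠ 0` in `ℤ³` there is a local box `Λ_N` such that, for all large `L`, under the finite-volume law `P_L = sourcedDoubleCurrentLaw 3 L β_c ({0}∆{x}) ({e₂}∆{x+e₂})`
(free box `Λ_L`; the trace `n̂₁ ∪ n̂₂` of two INDEPENDENT currents with sources `∂n₁ = {0,x}`,
`∂n₂ = {e₂, x+e₂}`, a push-forward of the tree's `doubleCurrentMeasure (freeBoxGraph 3 L) …`),
`1 − P_L[0 ↔ e₂ by open bonds inside Λ_N] ≤ C‖x‖^{-κ}`.  Equivalent to the infinite-volume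
`ParAvoidancePowerLaw` (`stub_localisation` below and its landed converse
`local_of_parAvoidancePowerLaw`), hence to the crux; predicted `κ = 2(Δ_ε − 2Δ_σ) ≈ 0.75`; FALSE on
`ℤ^d`, `d ≥ 5` (finite bubble).  All `d = 3` input of the line lives here; the natural choice is
`N ≍ ‖x‖/2` (one pinch: avoidance up to scale `‖x‖/2` already costs `‖x‖^{-(Δ_ε−2Δ_σ)}`). -/
theorem stub_localParAvoidancePowerLaw :
    ∃ κ C : ℝ, 0 < κ ∧ ∀ x : Site 3, x ≠ 0 → ∃ N : ℕ, ∀ᶠ L : ℕ in atTop,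
      1 - (sourcedDoubleCurrentLaw 3 L (criticalBeta 3) ({0} ∆ {x})
            ({(Pi.single 1 1 : Site 3)} ∆ {x + Pi.single 1 1})).real
          (openConnVia (withinGraph ⊤ (↑(box 3 N) : Set (Site 3))) 0 (Pi.single 1 1)) ≤
        C * (‖x‖ : ℝ) ^ (-κ) :=
  stub_telescoping stub_scaleMergingFloor

/-- The localisation step, inlined (verbatim the landed `parAvoidance_le_of_eventually_le` of
`Theorems/EnergyNotSigmaSquaredEnergyGapPowerLawLocalisation.lean`, p145825, kept here so that the
workfile elaborates on the import closure it was registered with): a finite-volume bound on the local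
avoidance for all large `L` passes to the infinite-volume parallel avoidance. -/
theorem parAvoidance_le_of_eventually_le_inline (x : Site 3) (N : ℕ) {τ : ℝ}
    (h : ∀ᶠ L : ℕ in atTop,
      1 - (sourcedDoubleCurrentLaw 3 L (criticalBeta 3) ({0} ∆ {x})
            ({(Pi.single 1 1 : Site 3)} ∆ {x + Pi.single 1 1})).real
          (openConnVia (withinGraph ⊤ (↑(box 3 N) : Set (Site 3))) 0 (Pi.single 1 1)) ≤ τ) :
    1 - (sourcedDoubleCurrentLawInf 3 (criticalBeta 3) ({0} ∆ {x})
          ({(Pi.single 1 1 : Site 3)} ∆ {x + Pi.single 1 1})).real (openConn 0 (Pi.single 1 1)) ≤ τ := by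
  set S : Set (BondConfig (Site 3)) :=
    openConnVia (withinGraph ⊤ (↑(box 3 N) : Set (Site 3))) 0 (Pi.single 1 1) with hS
  have hex : ∃ μ, IsSourcedDoubleCurrentLimit 3 (criticalBeta 3) ({0} ∆ {x})
      ({(Pi.single 1 1 : Site 3)} ∆ {x + Pi.single 1 1}) μ :=
    exists_isSourcedDoubleCurrentLimit 3 (criticalBeta_pos_holds (d := 3) (by norm_num))
      (even_card_singleton_symmDiff _ _) (even_card_singleton_symmDiff _ _)
  haveI := (isSourcedDoubleCurrentLimit_lawInf hex).isProbabilityMeasure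
  have hlim := tendsto_sourcedDoubleCurrentLaw_real hex
    (isLocalEvent_openConnVia_withinGraph_box N (0 : Site 3) (Pi.single 1 1))
  have h1 : 1 - (sourcedDoubleCurrentLawInf 3 (criticalBeta 3) ({0} ∆ {x})
      ({(Pi.single 1 1 : Site 3)} ∆ {x + Pi.single 1 1})).real S ≤ τ :=
    le_of_tendsto (hlim.const_sub 1) h
  have hsub : S ⊆ openConn 0 (Pi.single 1 1) := fun ω hω =>
    openClusterIn_subset_openCluster _ ω 0 hω
  have hmono : (sourcedDoubleCurrentLawInf 3 (criticalBeta 3) ({0} ∆ {x})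
      ({(Pi.single 1 1 : Site 3)} ∆ {x + Pi.single 1 1})).real S ≤
      (sourcedDoubleCurrentLawInf 3 (criticalBeta 3) ({0} ∆ {x})
        ({(Pi.single 1 1 : Site 3)} ∆ {x + Pi.single 1 1})).real (openConn 0 (Pi.single 1 1)) :=
    measureReal_mono hsub
  linarith

/-- **Stub 1-glue (S, LANDED p145825 as `Theorems/EnergyNotSigmaSquaredEnergyGapPowerLawLocalisation.lean`,
decl `Summit.CriticalPhenomena.Ising3DConformalLimit.EnergyNotSigmaSquaredEnergyGapPowerLaw.stub_localisation`;
localisation):** the finite-volume heart implies the infinite-volume `ParAvoidancePowerLaw`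
(`{0 ↔ e₂ inside Λ_N}` is a local event inside `{0 ↔ e₂}`, and `P_L → P` on local events —
`tendsto_sourcedDoubleCurrentLaw_real`, `exists_isSourcedDoubleCurrentLimit`, `β_c(3) > 0`). -/
theorem stub_localisation :
    (∃ κ C : ℝ, 0 < κ ∧ ∀ x : Site 3, x ≠ 0 → ∃ N : ℕ, ∀ᶠ L : ℕ in atTop,
      1 - (sourcedDoubleCurrentLaw 3 L (criticalBeta 3) ({0} ∆ {x})
            ({(Pi.single 1 1 : Site 3)} ∆ {x + Pi.single 1 1})).real
          (openConnVia (withinGraph ⊤ (↑(box 3 N) : Set (Site 3))) 0 (Pi.single 1 1)) ≤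
        C * (‖x‖ : ℝ) ^ (-κ)) →
    ∃ κ C : ℝ, 0 < κ ∧ ∀ x : Site 3, x ≠ 0 →
      1 - (sourcedDoubleCurrentLawInf 3 (criticalBeta 3) ({0} ∆ {x})
            ({(Pi.single 1 1 : Site 3)} ∆ {x + Pi.single 1 1})).real (openConn 0 (Pi.single 1 1)) ≤
        C * (‖x‖ : ℝ) ^ (-κ) := by
  -- LANDED (lead, p145825): Theorems/EnergyNotSigmaSquaredEnergyGapPowerLawLocalisation.lean, same proof
  rintro ⟨κ, C, hκ, h⟩
  refine ⟨κ, C, hκ, fun x hx => ?_⟩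
  obtain ⟨N, hN⟩ := h x hx
  exact parAvoidance_le_of_eventually_le_inline x N hN

/-- **Stub 1 of the birth skeleton (the infinite-volume heart — parallel adjacent avoidance decays as
a power), now DERIVED from stubs 1-loc and 1-glue.**
`1 − P^{{0}∆{x},{e₂}∆{x+e₂}}_{β_c}[0 ↔ e₂] ≤ C‖x‖^{-κ}` for all `x ≠ 0` in `ℤ³`, for some `κ > 0`:
two independent critical sourced currents `0 → x` and `e₂ → x + e₂` (infinite-volume sourced double
current `sourcedDoubleCurrentLawInf`) fail to connect `0` to `e₂` in `n̂₁ ∪ n̂₂` with polynomially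
small probability.  EQUIVALENT to the crux (`energyGapPowerLaw_iff_parAvoidancePowerLaw`, landed in
`Theorems/…OnePairing.lean`); FALSE on `ℤ^d`, `d ≥ 5`. -/
theorem stub_parAvoidancePowerLaw :
    ∃ κ C : ℝ, 0 < κ ∧ ∀ x : Site 3, x ≠ 0 →
      1 - (sourcedDoubleCurrentLawInf 3 (criticalBeta 3) ({0} ∆ {x})
            ({(Pi.single 1 1 : Site 3)} ∆ {x + Pi.single 1 1})).real (openConn 0 (Pi.single 1 1)) ≤
        C * (‖x‖ : ℝ) ^ (-κ) :=
  stub_localisation stub_localParAvoidancePowerLaw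

/-- **Stub 2a (S, provable now; growth along a ray).**  For a positive lattice function `F`, a
lattice vector `e`, a base point `x`, a number of steps `L`, a defect `η ∈ [0,1]` and a rate `a ≥ 0`:
if `a ≤ (1 − Lη)·F(x+e)/F(x)` and the second ratios at the interior points `x + (j+1)e`
(`j + 2 ≤ L`) satisfy `(1 − η)F(y)² ≤ F(y+e)F(y−e)`, then `a^L F(x) ≤ F(x + L e)`
(consecutive ratios `r_{j+1} ≥ (1−η) r_j`, Bernoulli `(1−η)^j ≥ 1 − jη ≥ 1 − Lη`, telescoping). -/
theorem stub_rayGrowth :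
    ∀ (F : Site 3 → ℝ) (e x : Site 3) (L : ℕ) (a η : ℝ),
      (∀ v, 0 < F v) → 0 ≤ η → η ≤ 1 → 0 ≤ a →
      a ≤ (1 - (L : ℝ) * η) * (F (x + e) / F x) →
      (∀ j : ℕ, j + 2 ≤ L →
        (1 - η) * F (x + (j + 1) • e) ^ 2 ≤ F (x + (j + 1) • e + e) * F (x + (j + 1) • e - e)) →
      a ^ L * F x ≤ F (x + L • e) :=
  -- LANDED (wave 1, p143171): Theorems/EnergyNotSigmaSquaredEnergyGapPowerLawRayGrowth.lean
  Summit.CriticalPhenomena.Ising3DConformalLimit.EnergyNotSigmaSquaredEnergyGapPowerLaw.stub_rayGrowth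

/-- **Stub 2b (M, provable now; the quantitative ray lemma for an abstract positive lattice function).**
Let `F > 0` on `ℤ³` and `e` a unit lattice vector.  Assume growth along rays (stub 2a for `F, e`), the
polynomial ray ceiling `F(x + K e) ≤ c⁻¹ K² F(x)` (`K ≥ 1`), and power-rate asymptotic log-convexity
`(1 − C‖y‖^{-κ}) F(y)² ≤ F(y+e) F(y−e)` for `y ≠ 0` (`0 < κ ≤ 1`, `0 ≤ C`).  Then for some `κ' > 0`,
`C'`, `R`: `F(x+e)/F(x) ≤ 1 + C'‖x‖^{-κ'}` whenever `‖x‖ ≥ R`.  Recipe: `κ' = κ/5`; if the ratio at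
`x`, `‖x‖ = N ≥ R`, exceeded `1 + N^{-κ'}`, growth with `L = 3K`, `K = ⌊72 N^{3κ'}/c⌋ + 1 ≤ N/6`,
`η = C (N/2)^{-κ}` (`Lη ≤ N^{-κ'}/4`), `a = 1 + N^{-κ'}/2` gives `a^{3K} F(x) ≤ F(x + 3K e) ≤ 9K²c⁻¹F(x)`,
while Bernoulli cubed gives `a^{3K} ≥ (1 + K N^{-κ'}/2)³ ≥ K³N^{-3κ'}/8`, i.e. `K ≤ 72N^{3κ'}/c`,
a contradiction. -/
theorem stub_rayRatioPowerBound :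
    ∀ (F : Site 3 → ℝ) (e : Site 3), ‖e‖ = 1 → (∀ v, 0 < F v) →
      (∀ (x : Site 3) (L : ℕ) (a η : ℝ), 0 ≤ η → η ≤ 1 → 0 ≤ a →
          a ≤ (1 - (L : ℝ) * η) * (F (x + e) / F x) →
          (∀ j : ℕ, j + 2 ≤ L →
            (1 - η) * F (x + (j + 1) • e) ^ 2 ≤ F (x + (j + 1) • e + e) * F (x + (j + 1) • e - e)) →
          a ^ L * F x ≤ F (x + L • e)) →
      ∀ c : ℝ, 0 < c → (∀ K : ℕ, 1 ≤ K → ∀ x : Site 3, F (x + K • e) ≤ (K : ℝ) ^ 2 / c * F x) →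
        ∀ κ C : ℝ, 0 < κ → κ ≤ 1 → 0 ≤ C →
          (∀ y : Site 3, y ≠ 0 → (1 - C * (‖y‖ : ℝ) ^ (-κ)) * F y ^ 2 ≤ F (y + e) * F (y - e)) →
          ∃ κ' C' R : ℝ, 0 < κ' ∧ ∀ x : Site 3, R ≤ ‖x‖ →
            F (x + e) / F x ≤ 1 + C' * (‖x‖ : ℝ) ^ (-κ') :=
  -- LANDED (wave 1, p143376): Theorems/EnergyNotSigmaSquaredEnergyGapPowerLawRayRatioPowerBound.lean
  Summit.CriticalPhenomena.Ising3DConformalLimit.EnergyNotSigmaSquaredEnergyGapPowerLaw.stub_rayRatioPowerBound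

/-- **Stub 3 (M, the reduction "one pairing suffices"; proved in this session as
`Theorems/EnergyNotSigmaSquaredEnergyGapPowerLawOnePairing.lean`, registered so that the reduction file
lands `--supports` by name):** parallel adjacent avoidance decay implies the crux.  Its proof is the glue
below (`logConvexity_of_parAvoidance`, `rayLogConcavity_of_stubs` with stubs 2a/2b, and
`gap_of_parAvoidance_of_logConcavity`). -/
theorem stub_onePairingReduction :
    (∃ κ C : ℝ, 0 < κ ∧ ∀ x : Site 3, x ≠ 0 →
      1 - (sourcedDoubleCurrentLawInf 3 (criticalBeta 3) ({0} ∆ {x})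
            ({(Pi.single 1 1 : Site 3)} ∆ {x + Pi.single 1 1})).real (openConn 0 (Pi.single 1 1)) ≤
        C * (‖x‖ : ℝ) ^ (-κ)) →
    ∃ κ C : ℝ, 0 < κ ∧ ∀ x : Site 3, x ≠ 0 →
      criticalCorr 3 4 ![0, (Pi.single 1 1 : Site 3), x, x + Pi.single 1 1] -
          criticalCorr 3 2 ![0, (Pi.single 1 1 : Site 3)] * criticalCorr 3 2 ![x, x + Pi.single 1 1] ≤
        C * (‖x‖ : ℝ) ^ (-κ) * criticalTwoPoint 3 x ^ 2 :=
  -- LANDED (lead, p144858): Theorems/EnergyNotSigmaSquaredEnergyGapPowerLawOnePairing.lean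
  Summit.CriticalPhenomena.Ising3DConformalLimit.EnergyNotSigmaSquaredEnergyGapPowerLaw.stub_onePairingReduction

/-! ## Proved glue -/

/-- `1 ≤ ‖x‖` for `x ≠ 0` in `ℤ³` (integer coordinates, sup norm). -/
theorem one_le_norm_of_ne_zero {x : Site 3} (hx : x ≠ 0) : 1 ≤ ‖x‖ := by
  obtain ⟨i, hi⟩ : ∃ i, x i ≠ 0 := by
    by_contra h
    push Not at h
    exact hx (funext h)
  calc (1 : ℝ) ≤ ‖x i‖ := by
        rw [Int.norm_eq_abs]
        exact_mod_cast Int.one_le_abs hi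
    _ ≤ ‖x‖ := norm_le_pi_norm x i

/-- The unit vector `e₂` has norm one. -/
theorem norm_e₂_eq_one : ‖(Pi.single 1 1 : Site 3)‖ = 1 := by
  rw [Pi.norm_single]; simp

/-- **The quantitative ray lemma for `G` in a unit direction `e`** (stubs 2a + 2b with the GKS ceiling
`exists_ray_ceiling`, normalisation `κ ↦ min κ 1`, `C ↦ max C 0` on `‖y‖ ≥ 1`, and small `x` absorbed
by `G(x+e)/G(x) ≤ G(e)⁻¹`): power-rate log-convexity of `G` in direction `e` forces
`G(x+e)/G(x) ≤ 1 + C'‖x‖^{-κ'}` for ALL `x ≠ 0`. -/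
theorem ratioPowerBound_of_logConvexity
    (hgrowth : ∀ (F : Site 3 → ℝ) (e x : Site 3) (L : ℕ) (a η : ℝ),
      (∀ v, 0 < F v) → 0 ≤ η → η ≤ 1 → 0 ≤ a →
      a ≤ (1 - (L : ℝ) * η) * (F (x + e) / F x) →
      (∀ j : ℕ, j + 2 ≤ L →
        (1 - η) * F (x + (j + 1) • e) ^ 2 ≤ F (x + (j + 1) • e + e) * F (x + (j + 1) • e - e)) →
      a ^ L * F x ≤ F (x + L • e))
    (hray : ∀ (F : Site 3 → ℝ) (e : Site 3), ‖e‖ = 1 → (∀ v, 0 < F v) →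
      (∀ (x : Site 3) (L : ℕ) (a η : ℝ), 0 ≤ η → η ≤ 1 → 0 ≤ a →
          a ≤ (1 - (L : ℝ) * η) * (F (x + e) / F x) →
          (∀ j : ℕ, j + 2 ≤ L →
            (1 - η) * F (x + (j + 1) • e) ^ 2 ≤ F (x + (j + 1) • e + e) * F (x + (j + 1) • e - e)) →
          a ^ L * F x ≤ F (x + L • e)) →
      ∀ c : ℝ, 0 < c → (∀ K : ℕ, 1 ≤ K → ∀ x : Site 3, F (x + K • e) ≤ (K : ℝ) ^ 2 / c * F x) →
        ∀ κ C : ℝ, 0 < κ → κ ≤ 1 → 0 ≤ C →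
          (∀ y : Site 3, y ≠ 0 → (1 - C * (‖y‖ : ℝ) ^ (-κ)) * F y ^ 2 ≤ F (y + e) * F (y - e)) →
          ∃ κ' C' R : ℝ, 0 < κ' ∧ ∀ x : Site 3, R ≤ ‖x‖ →
            F (x + e) / F x ≤ 1 + C' * (‖x‖ : ℝ) ^ (-κ'))
    {e : Site 3} (he : ‖e‖ = 1) {κ C : ℝ} (hκ : 0 < κ)
    (hconv : ∀ y : Site 3, y ≠ 0 →
      criticalTwoPoint 3 y ^ 2 - criticalTwoPoint 3 (y + e) * criticalTwoPoint 3 (y - e) ≤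
        C * (‖y‖ : ℝ) ^ (-κ) * criticalTwoPoint 3 y ^ 2) :
    ∃ κ' C' : ℝ, 0 < κ' ∧ ∀ x : Site 3, x ≠ 0 →
      criticalTwoPoint 3 (x + e) / criticalTwoPoint 3 x ≤ 1 + C' * (‖x‖ : ℝ) ^ (-κ') := by
  have hGpos : ∀ v, 0 < criticalTwoPoint 3 v := criticalTwoPoint_pos3
  -- normalise the exponent and the constant
  set κ₀ : ℝ := min κ 1 with hκ₀
  set C₀ : ℝ := max C 0 with hC₀
  have hκ₀pos : 0 < κ₀ := lt_min hκ one_pos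
  have hκ₀le : κ₀ ≤ 1 := min_le_right _ _
  have hC₀nn : 0 ≤ C₀ := le_max_right _ _
  have hconv' : ∀ y : Site 3, y ≠ 0 →
      (1 - C₀ * (‖y‖ : ℝ) ^ (-κ₀)) * criticalTwoPoint 3 y ^ 2 ≤
        criticalTwoPoint 3 (y + e) * criticalTwoPoint 3 (y - e) := by
    intro y hy
    have hy1 : 1 ≤ ‖y‖ := one_le_norm_of_ne_zero hy
    have hG2 : 0 ≤ criticalTwoPoint 3 y ^ 2 := sq_nonneg _
    have h1 : (‖y‖ : ℝ) ^ (-κ) ≤ ‖y‖ ^ (-κ₀) :=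
      Real.rpow_le_rpow_of_exponent_le hy1 (neg_le_neg (min_le_left _ _))
    have h2 : C * (‖y‖ : ℝ) ^ (-κ) ≤ C₀ * ‖y‖ ^ (-κ₀) :=
      (mul_le_mul_of_nonneg_right (le_max_left _ _) (Real.rpow_nonneg (norm_nonneg _) _)).trans
        (mul_le_mul_of_nonneg_left h1 hC₀nn)
    have h3 := hconv y hy
    nlinarith [mul_le_mul_of_nonneg_right h2 hG2]
  obtain ⟨c, hc, hceil⟩ := exists_ray_ceiling
  obtain ⟨κ', C', R, hκ', hR⟩ := hray (criticalTwoPoint 3) e he hGpos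
    (fun x L a η => hgrowth (criticalTwoPoint 3) e x L a η hGpos) c hc (hceil e he) κ₀ C₀ hκ₀pos
    hκ₀le hC₀nn hconv'
  -- absorb the points with `‖x‖ < R` using `G(x+e)/G(x) ≤ G(e)⁻¹`
  set R₁ : ℝ := max R 1 with hR₁
  have hR₁pos : 0 < R₁ := lt_of_lt_of_le one_pos (le_max_right _ _)
  have hGe := hGpos e
  refine ⟨κ', max C' 0 + (criticalTwoPoint 3 e)⁻¹ * R₁ ^ κ', hκ', fun x hx => ?_⟩
  have hx1 : 1 ≤ ‖x‖ := one_le_norm_of_ne_zero hx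
  have hxpos : 0 < ‖x‖ := lt_of_lt_of_le one_pos hx1
  have hρ : 0 ≤ (‖x‖ : ℝ) ^ (-κ') := Real.rpow_nonneg (norm_nonneg _) _
  have hratio_le : criticalTwoPoint 3 (x + e) / criticalTwoPoint 3 x ≤ (criticalTwoPoint 3 e)⁻¹ := by
    rw [div_le_iff₀ (hGpos x), ← div_eq_inv_mul, le_div_iff₀ hGe]
    exact criticalTwoPoint_add_mul_le x e
  have hA : 0 ≤ max C' 0 * (‖x‖ : ℝ) ^ (-κ') := mul_nonneg (le_max_right _ _) hρ
  have hB : 0 ≤ (criticalTwoPoint 3 e)⁻¹ * R₁ ^ κ' * (‖x‖ : ℝ) ^ (-κ') :=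
    mul_nonneg (mul_nonneg (inv_nonneg.2 hGe.le) (Real.rpow_nonneg hR₁pos.le _)) hρ
  by_cases hxR : R ≤ ‖x‖
  · have h := hR x hxR
    calc criticalTwoPoint 3 (x + e) / criticalTwoPoint 3 x ≤ 1 + C' * ‖x‖ ^ (-κ') := h
      _ ≤ 1 + max C' 0 * ‖x‖ ^ (-κ') := by
          gcongr; exact le_max_left _ _
      _ ≤ 1 + (max C' 0 + (criticalTwoPoint 3 e)⁻¹ * R₁ ^ κ') * ‖x‖ ^ (-κ') := by nlinarith
  · push Not at hxR
    have hxR₁ : ‖x‖ ≤ R₁ := hxR.le.trans (le_max_left _ _)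
    -- `1 ≤ R₁^κ' ‖x‖^{-κ'}`
    have hone : 1 ≤ R₁ ^ κ' * (‖x‖ : ℝ) ^ (-κ') := by
      rw [Real.rpow_neg hxpos.le, ← div_eq_mul_inv, one_le_div (Real.rpow_pos_of_pos hxpos _)]
      exact Real.rpow_le_rpow hxpos.le hxR₁ hκ'.le
    calc criticalTwoPoint 3 (x + e) / criticalTwoPoint 3 x ≤ (criticalTwoPoint 3 e)⁻¹ := hratio_le
      _ ≤ (criticalTwoPoint 3 e)⁻¹ * (R₁ ^ κ' * ‖x‖ ^ (-κ')) :=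
          le_mul_of_one_le_right (inv_nonneg.2 hGe.le) hone
      _ = (criticalTwoPoint 3 e)⁻¹ * R₁ ^ κ' * ‖x‖ ^ (-κ') := by ring
      _ ≤ 1 + (max C' 0 + (criticalTwoPoint 3 e)⁻¹ * R₁ ^ κ') * ‖x‖ ^ (-κ') := by nlinarith

/-- **Stub 2 of the birth skeleton, now a theorem: power-rate log-convexity of `G` in direction `e₂`
forces power-rate log-concavity** (the ray lemma in the directions `e₂` and `−e₂`, then
`G₊G₋/G² = (G(x+e₂)/G(x))·(G(x−e₂)/G(x)) ≤ (1 + Mρ)² ≤ 1 + (2M + M²)ρ` with `ρ = ‖x‖^{-κ'} ≤ 1`). -/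
theorem rayLogConcavity_of_stubs
    (hgrowth : ∀ (F : Site 3 → ℝ) (e x : Site 3) (L : ℕ) (a η : ℝ),
      (∀ v, 0 < F v) → 0 ≤ η → η ≤ 1 → 0 ≤ a →
      a ≤ (1 - (L : ℝ) * η) * (F (x + e) / F x) →
      (∀ j : ℕ, j + 2 ≤ L →
        (1 - η) * F (x + (j + 1) • e) ^ 2 ≤ F (x + (j + 1) • e + e) * F (x + (j + 1) • e - e)) →
      a ^ L * F x ≤ F (x + L • e))
    (hray : ∀ (F : Site 3 → ℝ) (e : Site 3), ‖e‖ = 1 → (∀ v, 0 < F v) →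
      (∀ (x : Site 3) (L : ℕ) (a η : ℝ), 0 ≤ η → η ≤ 1 → 0 ≤ a →
          a ≤ (1 - (L : ℝ) * η) * (F (x + e) / F x) →
          (∀ j : ℕ, j + 2 ≤ L →
            (1 - η) * F (x + (j + 1) • e) ^ 2 ≤ F (x + (j + 1) • e + e) * F (x + (j + 1) • e - e)) →
          a ^ L * F x ≤ F (x + L • e)) →
      ∀ c : ℝ, 0 < c → (∀ K : ℕ, 1 ≤ K → ∀ x : Site 3, F (x + K • e) ≤ (K : ℝ) ^ 2 / c * F x) →
        ∀ κ C : ℝ, 0 < κ → κ ≤ 1 → 0 ≤ C →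
          (∀ y : Site 3, y ≠ 0 → (1 - C * (‖y‖ : ℝ) ^ (-κ)) * F y ^ 2 ≤ F (y + e) * F (y - e)) →
          ∃ κ' C' R : ℝ, 0 < κ' ∧ ∀ x : Site 3, R ≤ ‖x‖ →
            F (x + e) / F x ≤ 1 + C' * (‖x‖ : ℝ) ^ (-κ')) :
    (∃ κ C : ℝ, 0 < κ ∧ ∀ x : Site 3, x ≠ 0 →
      criticalTwoPoint 3 x ^ 2 -
          criticalTwoPoint 3 (x + Pi.single 1 1) * criticalTwoPoint 3 (x - Pi.single 1 1) ≤
        C * (‖x‖ : ℝ) ^ (-κ) * criticalTwoPoint 3 x ^ 2) →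
    ∃ κ C : ℝ, 0 < κ ∧ ∀ x : Site 3, x ≠ 0 →
      criticalTwoPoint 3 (x + Pi.single 1 1) * criticalTwoPoint 3 (x - Pi.single 1 1) -
          criticalTwoPoint 3 x ^ 2 ≤
        C * (‖x‖ : ℝ) ^ (-κ) * criticalTwoPoint 3 x ^ 2 := by
  rintro ⟨κ, C, hκ, hconv⟩
  have hGpos : ∀ v, 0 < criticalTwoPoint 3 v := criticalTwoPoint_pos3
  have he : ‖(Pi.single 1 1 : Site 3)‖ = 1 := norm_e₂_eq_one
  have he' : ‖(-(Pi.single 1 1) : Site 3)‖ = 1 := by rw [norm_neg, he]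
  -- the convexity hypothesis in direction `-e₂` is the same statement
  have hconv' : ∀ y : Site 3, y ≠ 0 →
      criticalTwoPoint 3 y ^ 2 -
          criticalTwoPoint 3 (y + -(Pi.single 1 1)) * criticalTwoPoint 3 (y - -(Pi.single 1 1)) ≤
        C * (‖y‖ : ℝ) ^ (-κ) * criticalTwoPoint 3 y ^ 2 := by
    intro y hy
    rw [← sub_eq_add_neg, sub_neg_eq_add, mul_comm]
    exact hconv y hy
  obtain ⟨κ₁, C₁, hκ₁, h₁⟩ := ratioPowerBound_of_logConvexity hgrowth hray he hκ hconv
  obtain ⟨κ₂, C₂, hκ₂, h₂⟩ := ratioPowerBound_of_logConvexity hgrowth hray he' hκ hconv'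
  set κ' : ℝ := min κ₁ κ₂ with hκ'
  set M : ℝ := max C₁ 0 + max C₂ 0 with hM
  have hMnn : 0 ≤ M := add_nonneg (le_max_right _ _) (le_max_right _ _)
  refine ⟨κ', 2 * M + M ^ 2, lt_min hκ₁ hκ₂, fun x hx => ?_⟩
  have hx1 : 1 ≤ ‖x‖ := one_le_norm_of_ne_zero hx
  have hxpos : 0 < ‖x‖ := lt_of_lt_of_le one_pos hx1
  set ρ : ℝ := (‖x‖ : ℝ) ^ (-κ') with hρ
  have hρnn : 0 ≤ ρ := Real.rpow_nonneg (norm_nonneg _) _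
  have hρle : ρ ≤ 1 := Real.rpow_le_one_of_one_le_of_nonpos hx1 (neg_nonpos.2 (lt_min hκ₁ hκ₂).le)
  have hr1 : (‖x‖ : ℝ) ^ (-κ₁) ≤ ρ :=
    Real.rpow_le_rpow_of_exponent_le hx1 (neg_le_neg (min_le_left _ _))
  have hr2 : (‖x‖ : ℝ) ^ (-κ₂) ≤ ρ :=
    Real.rpow_le_rpow_of_exponent_le hx1 (neg_le_neg (min_le_right _ _))
  -- the two ratio bounds, upgraded to the common exponent and nonnegative constants
  have hq₁ : criticalTwoPoint 3 (x + Pi.single 1 1) / criticalTwoPoint 3 x ≤ 1 + M * ρ := by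
    have h := h₁ x hx
    have hup : C₁ * (‖x‖ : ℝ) ^ (-κ₁) ≤ M * ρ :=
      calc C₁ * (‖x‖ : ℝ) ^ (-κ₁) ≤ max C₁ 0 * ‖x‖ ^ (-κ₁) :=
            mul_le_mul_of_nonneg_right (le_max_left _ _) (Real.rpow_nonneg (norm_nonneg _) _)
        _ ≤ max C₁ 0 * ρ := mul_le_mul_of_nonneg_left hr1 (le_max_right _ _)
        _ ≤ M * ρ := mul_le_mul_of_nonneg_right (by rw [hM]; linarith [le_max_right C₂ 0]) hρnn
    linarith
  have hq₂ : criticalTwoPoint 3 (x - Pi.single 1 1) / criticalTwoPoint 3 x ≤ 1 + M * ρ := by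
    have h := h₂ x hx
    rw [← sub_eq_add_neg] at h
    have hup : C₂ * (‖x‖ : ℝ) ^ (-κ₂) ≤ M * ρ :=
      calc C₂ * (‖x‖ : ℝ) ^ (-κ₂) ≤ max C₂ 0 * ‖x‖ ^ (-κ₂) :=
            mul_le_mul_of_nonneg_right (le_max_left _ _) (Real.rpow_nonneg (norm_nonneg _) _)
        _ ≤ max C₂ 0 * ρ := mul_le_mul_of_nonneg_left hr2 (le_max_right _ _)
        _ ≤ M * ρ := mul_le_mul_of_nonneg_right (by rw [hM]; linarith [le_max_right C₁ 0]) hρnn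
    linarith
  -- multiply out
  have hGx := hGpos x
  have hG2 : 0 < criticalTwoPoint 3 x ^ 2 := pow_pos hGx 2
  have hqpos₁ : 0 ≤ criticalTwoPoint 3 (x + Pi.single 1 1) / criticalTwoPoint 3 x :=
    div_nonneg (hGpos _).le hGx.le
  have hqpos₂ : 0 ≤ criticalTwoPoint 3 (x - Pi.single 1 1) / criticalTwoPoint 3 x :=
    div_nonneg (hGpos _).le hGx.le
  have hprod : criticalTwoPoint 3 (x + Pi.single 1 1) / criticalTwoPoint 3 x *
      (criticalTwoPoint 3 (x - Pi.single 1 1) / criticalTwoPoint 3 x) ≤ (1 + M * ρ) * (1 + M * ρ) :=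
    mul_le_mul hq₁ hq₂ hqpos₂ (by nlinarith)
  have heq : criticalTwoPoint 3 (x + Pi.single 1 1) * criticalTwoPoint 3 (x - Pi.single 1 1) =
      criticalTwoPoint 3 (x + Pi.single 1 1) / criticalTwoPoint 3 x *
        (criticalTwoPoint 3 (x - Pi.single 1 1) / criticalTwoPoint 3 x) * criticalTwoPoint 3 x ^ 2 := by
    field_simp
  have hsq : (1 + M * ρ) * (1 + M * ρ) ≤ 1 + (2 * M + M ^ 2) * ρ := by
    have : M ^ 2 * ρ ^ 2 ≤ M ^ 2 * ρ := by
      have hρ2 : ρ ^ 2 ≤ ρ := by nlinarith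
      exact mul_le_mul_of_nonneg_left hρ2 (sq_nonneg _)
    nlinarith
  rw [heq]
  nlinarith [mul_le_mul_of_nonneg_right (hprod.trans hsq) hG2.le]

/-- **Tied pairings turn parallel avoidance decay into power-rate log-convexity**:
`G² − G₊G₋ = G²A_par − G₊G₋A_cross ≤ G²A_par`. -/
theorem logConvexity_of_parAvoidance
    (hpar : ∃ κ C : ℝ, 0 < κ ∧ ∀ x : Site 3, x ≠ 0 →
      1 - (sourcedDoubleCurrentLawInf 3 (criticalBeta 3) ({0} ∆ {x})
            ({(Pi.single 1 1 : Site 3)} ∆ {x + Pi.single 1 1})).real (openConn 0 (Pi.single 1 1)) ≤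
        C * (‖x‖ : ℝ) ^ (-κ)) :
    ∃ κ C : ℝ, 0 < κ ∧ ∀ x : Site 3, x ≠ 0 →
      criticalTwoPoint 3 x ^ 2 -
          criticalTwoPoint 3 (x + Pi.single 1 1) * criticalTwoPoint 3 (x - Pi.single 1 1) ≤
        C * (‖x‖ : ℝ) ^ (-κ) * criticalTwoPoint 3 x ^ 2 := by
  obtain ⟨κ, C, hκ, hC⟩ := hpar
  refine ⟨κ, C, hκ, fun x hx => ?_⟩
  have htie := (pairings_tied x).1
  have hA := hC x hx
  have hG2 : 0 ≤ criticalTwoPoint 3 x ^ 2 := sq_nonneg _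
  have hGG : 0 ≤ criticalTwoPoint 3 (x + Pi.single 1 1) * criticalTwoPoint 3 (x - Pi.single 1 1) :=
    mul_nonneg (criticalTwoPoint_nonneg' _) (criticalTwoPoint_nonneg' _)
  have hPc : (sourcedDoubleCurrentLawInf 3 (criticalBeta 3) ({0} ∆ {x + Pi.single 1 1})
      ({(Pi.single 1 1 : Site 3)} ∆ {x})).real (openConn 0 (Pi.single 1 1)) ≤ 1 :=
    sourcedDoubleCurrentLawInf_real_le_one _ _ _ _
  set Pp := (sourcedDoubleCurrentLawInf 3 (criticalBeta 3) ({0} ∆ {x})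
      ({(Pi.single 1 1 : Site 3)} ∆ {x + Pi.single 1 1})).real (openConn 0 (Pi.single 1 1)) with hPp
  set Pc := (sourcedDoubleCurrentLawInf 3 (criticalBeta 3) ({0} ∆ {x + Pi.single 1 1})
      ({(Pi.single 1 1 : Site 3)} ∆ {x})).real (openConn 0 (Pi.single 1 1)) with hPc'
  set G2 := criticalTwoPoint 3 x ^ 2 with hG2'
  set GG := criticalTwoPoint 3 (x + Pi.single 1 1) * criticalTwoPoint 3 (x - Pi.single 1 1) with hGG'
  have h1 : GG * Pc ≤ GG := mul_le_of_le_one_right hGG hPc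
  have h2 : G2 * (1 - Pp) ≤ G2 * (C * ‖x‖ ^ (-κ)) := mul_le_mul_of_nonneg_left hA hG2
  calc G2 - GG ≤ G2 - GG * Pc := by linarith
    _ = G2 * (1 - Pp) := by rw [← htie]; ring
    _ ≤ G2 * (C * ‖x‖ ^ (-κ)) := h2
    _ = C * ‖x‖ ^ (-κ) * G2 := by ring

/-- **GAP from parallel avoidance decay and a one-sided second-ratio power bound** (the assembly
algebra `T = 2G²A_par + (G₊G₋ − G²)`, exponents merged by `‖x‖ ≥ 1`). -/
theorem gap_of_parAvoidance_of_logConcavity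
    (hpar : ∃ κ C : ℝ, 0 < κ ∧ ∀ x : Site 3, x ≠ 0 →
      1 - (sourcedDoubleCurrentLawInf 3 (criticalBeta 3) ({0} ∆ {x})
            ({(Pi.single 1 1 : Site 3)} ∆ {x + Pi.single 1 1})).real (openConn 0 (Pi.single 1 1)) ≤
        C * (‖x‖ : ℝ) ^ (-κ))
    (hconc : ∃ κ C : ℝ, 0 < κ ∧ ∀ x : Site 3, x ≠ 0 →
      criticalTwoPoint 3 (x + Pi.single 1 1) * criticalTwoPoint 3 (x - Pi.single 1 1) -
          criticalTwoPoint 3 x ^ 2 ≤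
        C * (‖x‖ : ℝ) ^ (-κ) * criticalTwoPoint 3 x ^ 2) :
    EnergyGapPowerLaw := by
  obtain ⟨κ₁, C₁, hκ₁, h₁⟩ := hpar
  obtain ⟨κ₂, C₂, hκ₂, h₂⟩ := hconc
  refine ⟨min κ₁ κ₂, 2 * max C₁ 0 + max C₂ 0, lt_min hκ₁ hκ₂, fun x hx => ?_⟩
  have hx1 : 1 ≤ ‖x‖ := one_le_norm_of_ne_zero hx
  have hxpos : 0 < ‖x‖ := by linarith
  have hG2 : 0 ≤ criticalTwoPoint 3 x ^ 2 := sq_nonneg _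
  have hA := h₁ x hx
  have hS := h₂ x hx
  have hr1 : ‖x‖ ^ (-κ₁) ≤ ‖x‖ ^ (-(min κ₁ κ₂)) :=
    Real.rpow_le_rpow_of_exponent_le hx1 (neg_le_neg (min_le_left _ _))
  have hr2 : ‖x‖ ^ (-κ₂) ≤ ‖x‖ ^ (-(min κ₁ κ₂)) :=
    Real.rpow_le_rpow_of_exponent_le hx1 (neg_le_neg (min_le_right _ _))
  have hρ1 : 0 ≤ ‖x‖ ^ (-κ₁) := Real.rpow_nonneg hxpos.le _
  have hρ2 : 0 ≤ ‖x‖ ^ (-κ₂) := Real.rpow_nonneg hxpos.le _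
  have hρ : 0 ≤ ‖x‖ ^ (-(min κ₁ κ₂)) := Real.rpow_nonneg hxpos.le _
  set Pp := (sourcedDoubleCurrentLawInf 3 (criticalBeta 3) ({0} ∆ {x})
      ({(Pi.single 1 1 : Site 3)} ∆ {x + Pi.single 1 1})).real (openConn 0 (Pi.single 1 1)) with hPp
  set G2 := criticalTwoPoint 3 x ^ 2 with hG2'
  set GG := criticalTwoPoint 3 (x + Pi.single 1 1) * criticalTwoPoint 3 (x - Pi.single 1 1) with hGG'
  set ρ := ‖x‖ ^ (-(min κ₁ κ₂)) with hρ'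
  -- upgrade the two bounds to the common exponent and nonnegative constants
  have hA' : 1 - Pp ≤ max C₁ 0 * ρ :=
    hA.trans ((mul_le_mul_of_nonneg_right (le_max_left _ _) hρ1).trans
      (mul_le_mul_of_nonneg_left hr1 (le_max_right _ _)))
  have hS' : GG - G2 ≤ max C₂ 0 * ρ * G2 :=
    hS.trans (mul_le_mul_of_nonneg_right ((mul_le_mul_of_nonneg_right (le_max_left _ _) hρ2).trans
      (mul_le_mul_of_nonneg_left hr2 (le_max_right _ _))) hG2)
  have h4 : G2 * (1 - Pp) ≤ G2 * (max C₁ 0 * ρ) := mul_le_mul_of_nonneg_left hA' hG2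
  -- `T = G² (1 - 2 P_par) + G₊G₋ = 2 G² (1 - P_par) + (G₊G₋ - G²)`
  rw [adjacentTruncation_eq_ursell]
  show G2 * (1 - 2 * Pp) + GG ≤ (2 * max C₁ 0 + max C₂ 0) * ρ * G2
  nlinarith [h4, hS']

/-- **The composition** — concludes the crux BY NAME from the three registered stubs' statements:
parallel avoidance decay (stub 1), growth along a ray (stub 2a) and the quantitative ray lemma
(stub 2b). -/
theorem EnergyGapPowerLaw_of :
    (∃ κ C : ℝ, 0 < κ ∧ ∀ x : Site 3, x ≠ 0 →
      1 - (sourcedDoubleCurrentLawInf 3 (criticalBeta 3) ({0} ∆ {x})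
            ({(Pi.single 1 1 : Site 3)} ∆ {x + Pi.single 1 1})).real (openConn 0 (Pi.single 1 1)) ≤
        C * (‖x‖ : ℝ) ^ (-κ)) →
    (∀ (F : Site 3 → ℝ) (e x : Site 3) (L : ℕ) (a η : ℝ),
      (∀ v, 0 < F v) → 0 ≤ η → η ≤ 1 → 0 ≤ a →
      a ≤ (1 - (L : ℝ) * η) * (F (x + e) / F x) →
      (∀ j : ℕ, j + 2 ≤ L →
        (1 - η) * F (x + (j + 1) • e) ^ 2 ≤ F (x + (j + 1) • e + e) * F (x + (j + 1) • e - e)) →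
      a ^ L * F x ≤ F (x + L • e)) →
    (∀ (F : Site 3 → ℝ) (e : Site 3), ‖e‖ = 1 → (∀ v, 0 < F v) →
      (∀ (x : Site 3) (L : ℕ) (a η : ℝ), 0 ≤ η → η ≤ 1 → 0 ≤ a →
          a ≤ (1 - (L : ℝ) * η) * (F (x + e) / F x) →
          (∀ j : ℕ, j + 2 ≤ L →
            (1 - η) * F (x + (j + 1) • e) ^ 2 ≤ F (x + (j + 1) • e + e) * F (x + (j + 1) • e - e)) →
          a ^ L * F x ≤ F (x + L • e)) →
      ∀ c : ℝ, 0 < c → (∀ K : ℕ, 1 ≤ K → ∀ x : Site 3, F (x + K • e) ≤ (K : ℝ) ^ 2 / c * F x) →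
        ∀ κ C : ℝ, 0 < κ → κ ≤ 1 → 0 ≤ C →
          (∀ y : Site 3, y ≠ 0 → (1 - C * (‖y‖ : ℝ) ^ (-κ)) * F y ^ 2 ≤ F (y + e) * F (y - e)) →
          ∃ κ' C' R : ℝ, 0 < κ' ∧ ∀ x : Site 3, R ≤ ‖x‖ →
            F (x + e) / F x ≤ 1 + C' * (‖x‖ : ℝ) ^ (-κ')) →
    EnergyGapPowerLaw :=
  fun hpar hgrowth hray =>
    gap_of_parAvoidance_of_logConcavity hpar
      (rayLogConcavity_of_stubs hgrowth hray (logConvexity_of_parAvoidance hpar))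

/-- `stub_onePairingReduction` is exactly what the glue proves (so registering it loses nothing): the
conclusion is the crux UNFOLDED (so that the registered composition below is the only theorem of this
file whose type is the crux by name). -/
theorem stub_onePairingReduction_of_glue :
    (∃ κ C : ℝ, 0 < κ ∧ ∀ x : Site 3, x ≠ 0 →
      1 - (sourcedDoubleCurrentLawInf 3 (criticalBeta 3) ({0} ∆ {x})
            ({(Pi.single 1 1 : Site 3)} ∆ {x + Pi.single 1 1})).real (openConn 0 (Pi.single 1 1)) ≤
        C * (‖x‖ : ℝ) ^ (-κ)) →
    ∃ κ C : ℝ, 0 < κ ∧ ∀ x : Site 3, x ≠ 0 →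
      criticalCorr 3 4 ![0, (Pi.single 1 1 : Site 3), x, x + Pi.single 1 1] -
          criticalCorr 3 2 ![0, (Pi.single 1 1 : Site 3)] * criticalCorr 3 2 ![x, x + Pi.single 1 1] ≤
        C * (‖x‖ : ℝ) ^ (-κ) * criticalTwoPoint 3 x ^ 2 :=
  fun hpar => EnergyGapPowerLaw_of hpar stub_rayGrowth stub_rayRatioPowerBound

/-- **The registered composition** — the crux BY NAME from the registered stubs
`stub_localParAvoidancePowerLaw` (open heart, finite volume), `stub_localisation` (glue) and
`stub_onePairingReduction` (the reduction). -/
theorem energyGapPowerLaw_skeleton : EnergyGapPowerLaw :=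
  stub_onePairingReduction (stub_localisation (stub_telescoping stub_scaleMergingFloor))

end Summit.CriticalPhenomena.Ising3DConformalLimit.Cruxes.EnergyGapPowerLaw.Birth
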